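import Summits.ValiantsHypothesis.ValiantsHypothesis.Theses.GaugeDescent
import Summits.ValiantsHypothesis.ValiantsHypothesis.Theorems.GaugeDescentDescentGlue
import Summits.ValiantsHypothesis.ValiantsHypothesis.Theorems.GaugeDescentModPCollapse
import HarnessLib

/-!
# Route GaugeDescent — `Assembly` (stmt-ValiantsHypothesis-14335) and the reduction of the crux
# `BoolGrhFree` to `GeomRigidity`

With the two glue items of the route now PROVED in the tree — `DescentGlue`
(`descentGlue_proof : GeomRigidity → PrimeFieldTransfer`, stmt-6637) and `ModPCollapse`
(`modPCollapse_proof : PrimeFieldTransfer → VP_ℂ = VNP_ℂ → NP ⊆ P/poly`, stmt-6638) — the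
route's assembly item is pure composition:

* `boolGrhFree_of_geomRigidity : GeomRigidity → BoolGrhFree` — the route's rank-4 crux
  `BoolGrhFree` (GRH-free Boolean transfer `VP_ℂ = VNP_ℂ → NP ⊆ P/poly`, stmt-0345, OPEN) is
  REDUCED to the rank-2 crux `GeomRigidity` (torus rigidity of some optimal skeleton, OPEN);
* `assembly_proof : Assembly` = `GeomRigidity → NP ⊄ P/poly → VP_ℂ ≠ VNP_ℂ` (stmt-14335).

Honest framing: `GeomRigidity` and `NP ⊄ P/poly` are OPEN; this file proves implications between
the route's items only. `VP ≠ VNP` is NOT proved and nothing here is progress on it.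
-/

set_option linter.dupNamespace false

namespace Summit.ValiantsHypothesis.ValiantsHypothesis.Theorems.GaugeDescent

open Summit.ValiantsHypothesis.ValiantsHypothesis.Theses.GaugeDescent

/-- **The crux `BoolGrhFree` follows from the crux `GeomRigidity`** (composition of the proved
glues `DescentGlue` and `ModPCollapse`). [cite: Burgisser2000TCS, Cor. 1.2(1) and §5 (A3)] -/
theorem boolGrhFree_of_geomRigidity : GeomRigidity → BoolGrhFree :=
  fun hR hEq => modPCollapse_proof (DescentGlue.descentGlue_proof hR) hEq

/-- **`Assembly` (stmt-ValiantsHypothesis-14335): `GeomRigidity → NP ⊄ P/poly → VP_ℂ ≠ VNP_ℂ`.**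
[cite: Burgisser2000TCS, Cor. 1.2(1)] -/
theorem assembly_proof : Assembly :=
  fun hR hNP hEq => hNP (boolGrhFree_of_geomRigidity hR hEq)

end Summit.ValiantsHypothesis.ValiantsHypothesis.Theorems.GaugeDescent
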